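import Literature.Analysis.Potential.HarmonicPolynomialGaussianOrthogonality
import Literature.Algebra.Polynomial.LaplacianOrthogonalInvariance
import Mathlib
import HarnessLib

/-!
# The Gaussian mean-value property of harmonic polynomials and the real generating identity

For a real harmonic homogeneous polynomial `H` of degree `k` on `ℝⁿ`, `b > 0`, and every `w ∈ ℝⁿ`:

* ★ `integral_eval_translate_mul_exp` (MEAN VALUE, Gaussian weight): `∫_{ℝⁿ} H(x + w) e^{−b‖x‖²} dx = (π/b)^{n/2} · H(w)`
  — the mean-value property of harmonic functions [cite: AxlerBourdonRamey2001, Thm. 1.4] for the radial probability weight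
  `e^{−b‖x‖²}`, proved here ALGEBRAICALLY: the translate `x ↦ H(x + w)` is a harmonic polynomial, its homogeneous components are
  harmonic (`laplacian_homogeneousComponent`), and every harmonic homogeneous polynomial of positive degree is Gaussian-orthogonal to
  the constants (✓ `Literature.Analysis.Potential.integral_harmonic_mul_exp_eq_zero`);
* ★ `integral_eval_mul_exp_inner` (REAL GENERATING IDENTITY): `∫ H(x) e^{−b‖x‖² + s⟪ξ,x⟫} dx = (π/b)^{n/2} e^{s²‖ξ‖²/(4b)} (s/(2b))^k H(ξ)`
  for real `s`, `ξ ∈ ℝⁿ` (complete the square + mean value + homogeneity).  Its analytic continuation to complex `s` is HECKE'S IDENTITY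
  [cite: SteinWeiss1971, Ch. IV Thm. 3.4] (`Literature/Analysis/Fourier/HeckeIdentity.lean`).

Private infrastructure: `pderiv`/Laplacian of homogeneous components (`coeff_pderiv`, `coeff_homogeneousComponent`), the translated polynomial
`bind₁ (Xᵢ + C wᵢ) H` and its evaluation, polynomial × Gaussian integrability.  Mathlib has no harmonic polynomials.
-/

set_option autoImplicit false

noncomputable section

namespace Literature.Analysis.Potential

open MvPolynomial _root_.MeasureTheory
open scoped BigOperators RealInnerProductSpace
open Literature.Algebra.Polynomial (pderiv_bind₁)

variable {n : ℕ}

/-! ## § 1. Partial derivatives and Laplacians of homogeneous components -/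

/-- `∂ᵢ (P)_{m+1} = (∂ᵢ P)_m` for the homogeneous components. [folklore] -/
private theorem pderiv_homogeneousComponent_succ (P : MvPolynomial (Fin n) ℝ) (i : Fin n) (m : ℕ) :
    pderiv i (homogeneousComponent (m + 1) P) = homogeneousComponent m (pderiv i P) := by
  classical
  ext d
  rw [coeff_pderiv, coeff_homogeneousComponent, coeff_homogeneousComponent, coeff_pderiv]
  have hdeg : (d + Finsupp.single i 1).degree = d.degree + 1 := by
    rw [map_add, Finsupp.degree_single]
  rw [hdeg]
  by_cases h : d.degree = m
  · rw [if_pos h, if_pos (by omega)]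
  · rw [if_neg h, if_neg (by omega), zero_mul]

/-- `∂ᵢ (P)_0 = 0`. [folklore] -/
private theorem pderiv_homogeneousComponent_zero (P : MvPolynomial (Fin n) ℝ) (i : Fin n) :
    pderiv i (homogeneousComponent 0 P) = 0 := by
  rw [homogeneousComponent_zero, pderiv_C]

/-- **Homogeneous components of a harmonic polynomial are harmonic.** [folklore] -/
private theorem laplacian_homogeneousComponent (P : MvPolynomial (Fin n) ℝ)
    (hP : ∑ i, pderiv i (pderiv i P) = 0) (m : ℕ) :
    ∑ i, pderiv i (pderiv i (homogeneousComponent m P)) = 0 := by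
  rcases m with _ | m
  · simp
  rcases m with _ | m
  · simp [pderiv_homogeneousComponent_succ]
  · have h : ∑ i, pderiv i (pderiv i (homogeneousComponent (m + 2) P))
        = homogeneousComponent m (∑ i, pderiv i (pderiv i P)) := by
      rw [map_sum]
      exact Finset.sum_congr rfl fun i _ => by
        rw [pderiv_homogeneousComponent_succ, pderiv_homogeneousComponent_succ]
    rw [h, hP, map_zero]

/-! ## § 2. The translated polynomial -/

/-- Evaluation of the translate: `(bind₁ (X + C w) H)(x) = H(x + w)`. [folklore] -/
private theorem eval_translate (H : MvPolynomial (Fin n) ℝ) (w x : Fin n → ℝ) :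
    eval x (bind₁ (fun i => X i + C (w i)) H) = eval (fun i => x i + w i) H := by
  rw [show eval x (bind₁ (fun i => X i + C (w i)) H) = eval (fun i => eval x (X i + C (w i))) H from
    eval₂Hom_bind₁ (RingHom.id ℝ) x _ H]
  have h : (fun i => eval x (X i + C (w i))) = fun i => x i + w i := by
    funext i; simp
  rw [h]

/-- The translate of a harmonic polynomial is harmonic. [folklore] -/
private theorem laplacian_translate (H : MvPolynomial (Fin n) ℝ) (hH : ∑ i, pderiv i (pderiv i H) = 0) (w : Fin n → ℝ) :
    ∑ i, pderiv i (pderiv i (bind₁ (fun j => X j + C (w j)) H)) = 0 := by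
  classical
  have hstep : ∀ (Q : MvPolynomial (Fin n) ℝ) (i : Fin n),
      pderiv i (bind₁ (fun j => X j + C (w j)) Q) = bind₁ (fun j => X j + C (w j)) (pderiv i Q) := by
    intro Q i
    rw [pderiv_bind₁]
    have : ∀ j, pderiv i (X j + C (w j) : MvPolynomial (Fin n) ℝ) = if j = i then 1 else 0 := by
      intro j
      rw [map_add, pderiv_C, add_zero, pderiv_X, Pi.single_apply]
    simp_rw [this, ite_mul, one_mul, zero_mul, Finset.sum_ite_eq', Finset.mem_univ, if_true]
  simp_rw [hstep, ← map_sum, hH, map_zero]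

/-- `φ(c • x) = c^m φ(x)` for `φ` homogeneous of degree `m`. [folklore] -/
private theorem eval_smul_of_isHomogeneous' {φ : MvPolynomial (Fin n) ℝ} {m : ℕ} (hφ : φ.IsHomogeneous m)
    (c : ℝ) (x : Fin n → ℝ) : eval (c • x) φ = c ^ m * eval x φ := by
  classical
  rw [eval_eq, eval_eq, Finset.mul_sum]
  refine Finset.sum_congr rfl fun d hd => ?_
  simp only [Pi.smul_apply, smul_eq_mul, mul_pow, Finset.prod_mul_distrib, Finset.prod_pow_eq_pow_sum]
  rw [← hφ.degree_eq_sum_deg_support hd]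
  ring

/-! ## § 3. Integrability of polynomial functions against Gaussians (private copies) -/

/-- The Gaussian `e^{−a‖x‖²}` is integrable on `ℝⁿ` (`a > 0`). [folklore] -/
private theorem integrable_exp_neg_mul_sq_norm' {a : ℝ} (ha : 0 < a) :
    Integrable (fun x : EuclideanSpace ℝ (Fin n) => Real.exp (-(a * ‖x‖ ^ 2))) := by
  refine Integrable.of_integral_ne_zero (fun h => ?_)
  have h1 := GaussianFourier.integral_rexp_neg_mul_sq_norm (V := EuclideanSpace ℝ (Fin n)) ha
  have h2 : (fun v : EuclideanSpace ℝ (Fin n) => Real.exp (-a * ‖v‖ ^ 2)) = fun v => Real.exp (-(a * ‖v‖ ^ 2)) := by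
    funext v; ring_nf
  rw [h2, h] at h1
  have : (0 : ℝ) < (Real.pi / a) ^ (Module.finrank ℝ (EuclideanSpace ℝ (Fin n)) / 2 : ℝ) := by positivity
  linarith

/-- Polynomial functions times Gaussians are integrable (private copy of the orthogonality file's lemma). [folklore] -/
private theorem integrable_eval_mul_exp' (P : MvPolynomial (Fin n) ℝ) {a : ℝ} (ha : 0 < a) :
    Integrable (fun x : EuclideanSpace ℝ (Fin n) => eval (WithLp.ofLp x) P * Real.exp (-(a * ‖x‖ ^ 2))) := by
  induction P using MvPolynomial.induction_on generalizing a with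
  | C c =>
    simpa using (integrable_exp_neg_mul_sq_norm' ha).const_mul c
  | add p q hp hq =>
    refine ((hp ha).add (hq ha)).congr (Filter.Eventually.of_forall fun x => ?_)
    simp only [Pi.add_apply, map_add, add_mul]
  | mul_X p i hp =>
    have ha2 : 0 < a / 2 := by positivity
    have hmeas : AEStronglyMeasurable (fun x : EuclideanSpace ℝ (Fin n) => x i * Real.exp (-(a / 2 * ‖x‖ ^ 2))) volume := by
      have : Continuous fun x : EuclideanSpace ℝ (Fin n) => x i * Real.exp (-(a / 2 * ‖x‖ ^ 2)) := by fun_prop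
      exact this.aestronglyMeasurable
    have hbd : ∀ x : EuclideanSpace ℝ (Fin n), |x i| * Real.exp (-(a / 2 * ‖x‖ ^ 2)) ≤ (1 + 1 / (a / 2)) / 2 := by
      intro x
      have hxi : |x i| ≤ ‖x‖ := by
        have := PiLp.norm_apply_le x i
        rwa [Real.norm_eq_abs] at this
      have hexp1 : Real.exp (-(a / 2 * ‖x‖ ^ 2)) ≤ 1 := by
        rw [Real.exp_le_one_iff]; nlinarith [norm_nonneg x]
      have hexp2 : a / 2 * ‖x‖ ^ 2 * Real.exp (-(a / 2 * ‖x‖ ^ 2)) ≤ 1 := by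
        have h := Real.add_one_le_exp (a / 2 * ‖x‖ ^ 2)
        have hpos : 0 < Real.exp (a / 2 * ‖x‖ ^ 2) := Real.exp_pos _
        rw [Real.exp_neg, mul_inv_le_iff₀ hpos]
        nlinarith [norm_nonneg x]
      have hamgm : ‖x‖ ≤ (1 + ‖x‖ ^ 2) / 2 := by nlinarith [sq_nonneg (‖x‖ - 1)]
      have he0 : 0 ≤ Real.exp (-(a / 2 * ‖x‖ ^ 2)) := (Real.exp_pos _).le
      calc |x i| * Real.exp (-(a / 2 * ‖x‖ ^ 2))
          ≤ (1 + ‖x‖ ^ 2) / 2 * Real.exp (-(a / 2 * ‖x‖ ^ 2)) := mul_le_mul_of_nonneg_right (hxi.trans hamgm) he0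
        _ = (Real.exp (-(a / 2 * ‖x‖ ^ 2)) + (1 / (a / 2)) * (a / 2 * ‖x‖ ^ 2 * Real.exp (-(a / 2 * ‖x‖ ^ 2)))) / 2 := by
            field_simp
        _ ≤ (1 + (1 / (a / 2)) * 1) / 2 := by gcongr
        _ = (1 + 1 / (a / 2)) / 2 := by ring
    have h := (hp ha2).mul_bdd hmeas (c := (1 + 1 / (a / 2)) / 2)
      (Filter.Eventually.of_forall fun x => by
        rw [Real.norm_eq_abs, abs_mul, abs_of_pos (Real.exp_pos _)]
        exact hbd x)
    refine h.congr (Filter.Eventually.of_forall fun x => ?_)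
    simp only [map_mul, eval_X]
    have : Real.exp (-(a * ‖x‖ ^ 2)) = Real.exp (-(a / 2 * ‖x‖ ^ 2)) * Real.exp (-(a / 2 * ‖x‖ ^ 2)) := by
      rw [← Real.exp_add]; ring_nf
    rw [this]; ring

/-! ## § 4. The Gaussian mean-value property -/

/-- ★ **Gaussian mean-value property of harmonic polynomials**: for `H` harmonic on `ℝⁿ`, `b > 0`, `w ∈ ℝⁿ`,
`∫ H(x + w) e^{−b‖x‖²} dx = (π/b)^{n/2} H(w)`. [cite: AxlerBourdonRamey2001, Thm. 1.4] -/
theorem integral_eval_translate_mul_exp (H : MvPolynomial (Fin n) ℝ) (hH : ∑ i, pderiv i (pderiv i H) = 0)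
    {b : ℝ} (hb : 0 < b) (w : EuclideanSpace ℝ (Fin n)) :
    ∫ x : EuclideanSpace ℝ (Fin n), eval (fun i => x i + w i) H * Real.exp (-(b * ‖x‖ ^ 2))
      = (Real.pi / b) ^ (n / 2 : ℝ) * eval (WithLp.ofLp w) H := by
  classical
  -- the translate and its homogeneous decomposition
  set K : MvPolynomial (Fin n) ℝ := bind₁ (fun i => X i + C (w i)) H with hK
  have hKharm : ∑ i, pderiv i (pderiv i K) = 0 := laplacian_translate H hH (WithLp.ofLp w)
  have hKeval : ∀ x : EuclideanSpace ℝ (Fin n), eval (fun i => x i + w i) H = eval (WithLp.ofLp x) K := by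
    intro x
    rw [hK, eval_translate]
  have hK0 : eval (WithLp.ofLp w) H = coeff 0 K := by
    have h := eval_translate H (WithLp.ofLp w) 0
    rw [← hK] at h
    simp only [Pi.zero_apply, zero_add] at h
    have h0 : coeff 0 K = eval (0 : Fin n → ℝ) K := by
      rw [MvPolynomial.eval_zero]; rfl
    rw [h0, h]
  -- decompose `K = Σ_{m ≤ N} K_m`
  set N : ℕ := K.totalDegree with hN
  have hdecomp : ∀ x : EuclideanSpace ℝ (Fin n), eval (WithLp.ofLp x) K
      = ∑ m ∈ Finset.range (N + 1), eval (WithLp.ofLp x) (homogeneousComponent m K) := by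
    intro x
    conv_lhs => rw [← sum_homogeneousComponent (φ := K)]
    rw [map_sum]
  -- integrate term by term: positive degrees vanish by orthogonality with the constant `1`
  have hterm : ∀ m ∈ Finset.range (N + 1), m ≠ 0 →
      ∫ x : EuclideanSpace ℝ (Fin n), eval (WithLp.ofLp x) (homogeneousComponent m K) * Real.exp (-(b * ‖x‖ ^ 2)) = 0 := by
    intro m _ hm
    have h := integral_harmonic_mul_exp_eq_zero (n := n) (1 : MvPolynomial (Fin n) ℝ) (homogeneousComponent m K)
      (k := 0) (l := m) (isHomogeneous_one _ _) (homogeneousComponent_isHomogeneous m K) (by simp)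
      (laplacian_homogeneousComponent K hKharm m) (Ne.symm hm) hb
    simpa using h
  have hint : ∀ m ∈ Finset.range (N + 1), Integrable (fun x : EuclideanSpace ℝ (Fin n) =>
      eval (WithLp.ofLp x) (homogeneousComponent m K) * Real.exp (-(b * ‖x‖ ^ 2))) :=
    fun m _ => integrable_eval_mul_exp' _ hb
  calc ∫ x : EuclideanSpace ℝ (Fin n), eval (fun i => x i + w i) H * Real.exp (-(b * ‖x‖ ^ 2))
      = ∫ x : EuclideanSpace ℝ (Fin n), ∑ m ∈ Finset.range (N + 1),
          eval (WithLp.ofLp x) (homogeneousComponent m K) * Real.exp (-(b * ‖x‖ ^ 2)) := by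
        refine integral_congr_ae (Filter.Eventually.of_forall fun x => ?_)
        simp only [hKeval, hdecomp, Finset.sum_mul]
    _ = ∑ m ∈ Finset.range (N + 1), ∫ x : EuclideanSpace ℝ (Fin n),
          eval (WithLp.ofLp x) (homogeneousComponent m K) * Real.exp (-(b * ‖x‖ ^ 2)) :=
        integral_finsetSum _ hint
    _ = ∫ x : EuclideanSpace ℝ (Fin n), eval (WithLp.ofLp x) (homogeneousComponent 0 K) * Real.exp (-(b * ‖x‖ ^ 2)) := by
        rw [Finset.sum_eq_single 0 (fun m hm hm0 => hterm m hm hm0) (fun h => absurd (Finset.mem_range.2 (Nat.succ_pos N)) h)]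
    _ = (Real.pi / b) ^ (n / 2 : ℝ) * eval (WithLp.ofLp w) H := by
        simp only [homogeneousComponent_zero, eval_C]
        rw [integral_const_mul, hK0]
        have h1 := GaussianFourier.integral_rexp_neg_mul_sq_norm (V := EuclideanSpace ℝ (Fin n)) hb
        have h2 : (fun v : EuclideanSpace ℝ (Fin n) => Real.exp (-b * ‖v‖ ^ 2)) = fun v => Real.exp (-(b * ‖v‖ ^ 2)) := by
          funext v; ring_nf
        rw [h2, finrank_euclideanSpace_fin] at h1
        rw [h1, mul_comm]

/-! ## § 5. The real generating identity (complete the square) -/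

/-- ★ **Real generating identity**: for `H` harmonic homogeneous of degree `k` on `ℝⁿ`, `b > 0`, `ξ ∈ ℝⁿ` and REAL `s`,
`∫ H(x) e^{−b‖x‖² + s⟪ξ,x⟫} dx = (π/b)^{n/2} e^{s²‖ξ‖²/(4b)} (s/(2b))^k H(ξ)`.  (Hecke's identity is its continuation to `s = −i`.)
[cite: SteinWeiss1971, Ch. IV Thm. 3.4] -/
theorem integral_eval_mul_exp_inner (H : MvPolynomial (Fin n) ℝ) {k : ℕ} (hHk : H.IsHomogeneous k)
    (hH : ∑ i, pderiv i (pderiv i H) = 0) {b : ℝ} (hb : 0 < b) (ξ : EuclideanSpace ℝ (Fin n)) (s : ℝ) :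
    ∫ x : EuclideanSpace ℝ (Fin n), eval (WithLp.ofLp x) H * Real.exp (-(b * ‖x‖ ^ 2) + s * ⟪ξ, x⟫)
      = (Real.pi / b) ^ (n / 2 : ℝ) * Real.exp (s ^ 2 * ‖ξ‖ ^ 2 / (4 * b)) * ((s / (2 * b)) ^ k * eval (WithLp.ofLp ξ) H) := by
  -- the centre `w = sξ/(2b)`
  set w : EuclideanSpace ℝ (Fin n) := (s / (2 * b)) • ξ with hw
  -- complete the square: `−b‖x‖² + s⟪ξ,x⟫ = −b‖x − w‖² + b‖w‖²`
  have hsq : ∀ x : EuclideanSpace ℝ (Fin n), -(b * ‖x‖ ^ 2) + s * ⟪ξ, x⟫ = -(b * ‖x - w‖ ^ 2) + b * ‖w‖ ^ 2 := by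
    intro x
    rw [hw, norm_sub_sq_real, inner_smul_right, real_inner_comm ξ x, norm_smul, Real.norm_eq_abs, mul_pow, sq_abs]
    field_simp
    ring
  have hbw : b * ‖w‖ ^ 2 = s ^ 2 * ‖ξ‖ ^ 2 / (4 * b) := by
    rw [hw, norm_smul, Real.norm_eq_abs, mul_pow, sq_abs]
    field_simp
    ring
  -- translate: `∫ H(x) e^{−b‖x−w‖²} = ∫ H(x + w) e^{−b‖x‖²}`
  have htrans : ∫ x : EuclideanSpace ℝ (Fin n), eval (WithLp.ofLp x) H * Real.exp (-(b * ‖x - w‖ ^ 2))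
      = ∫ x : EuclideanSpace ℝ (Fin n), eval (fun i => x i + w i) H * Real.exp (-(b * ‖x‖ ^ 2)) := by
    have h := integral_add_right_eq_self (μ := (volume : Measure (EuclideanSpace ℝ (Fin n))))
      (fun x : EuclideanSpace ℝ (Fin n) => eval (WithLp.ofLp x) H * Real.exp (-(b * ‖x - w‖ ^ 2))) w
    rw [← h]
    refine integral_congr_ae (Filter.Eventually.of_forall fun x => ?_)
    simp only [add_sub_cancel_right]
    rfl
  calc ∫ x : EuclideanSpace ℝ (Fin n), eval (WithLp.ofLp x) H * Real.exp (-(b * ‖x‖ ^ 2) + s * ⟪ξ, x⟫)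
      = ∫ x : EuclideanSpace ℝ (Fin n), Real.exp (b * ‖w‖ ^ 2) * (eval (WithLp.ofLp x) H * Real.exp (-(b * ‖x - w‖ ^ 2))) := by
        refine integral_congr_ae (Filter.Eventually.of_forall fun x => ?_)
        simp only [hsq, Real.exp_add]; ring
    _ = Real.exp (b * ‖w‖ ^ 2) * ∫ x : EuclideanSpace ℝ (Fin n), eval (fun i => x i + w i) H * Real.exp (-(b * ‖x‖ ^ 2)) := by
        rw [integral_const_mul, htrans]
    _ = Real.exp (b * ‖w‖ ^ 2) * ((Real.pi / b) ^ (n / 2 : ℝ) * eval (WithLp.ofLp w) H) := by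
        rw [integral_eval_translate_mul_exp H hH hb w]
    _ = (Real.pi / b) ^ (n / 2 : ℝ) * Real.exp (s ^ 2 * ‖ξ‖ ^ 2 / (4 * b)) * ((s / (2 * b)) ^ k * eval (WithLp.ofLp ξ) H) := by
        rw [hbw]
        have hhom : eval (WithLp.ofLp w) H = (s / (2 * b)) ^ k * eval (WithLp.ofLp ξ) H := by
          rw [hw, WithLp.ofLp_smul, eval_smul_of_isHomogeneous' hHk]
        rw [hhom]; ring

end Literature.Analysis.Potential

end
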